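import Literature.MathematicalPhysics.QuantumFieldTheory.Balaban1983to89.B12Eq443SymbolHessian
import Literature.MathematicalPhysics.QuantumFieldTheory.Balaban1983to89.B4TorusKernel

/-!
# B12 (4.43)/(4.45) pp. 291–292, the FIRST «=»: the lattice moments of the kernel `Δ_{j,μν}(x)` of Bałaban's `Δ_j`
# ARE the derivatives of its symbol at `p′ = 0` — `Σ_y Δ_{j,μν}(x−y)(y_κ−x_κ)(y_λ−x_λ) = −(∂²/∂p′_κ∂p′_λ)Δ̃_{j,μν}(0)`,
# `Σ_y Δ_{j,μν}(x−y)(y_κ−x_κ) = ((1/i)(∂/∂p′_κ)Δ̃_{j,μν})(0)` — hence (with `B12Eq443SymbolHessian`) the full displays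

statement-level skeleton of published theorems with citation tags; proofs where landed; nothing here is a
claim about the Yang–Mills mass gap.

Sources: T. Bałaban, *Renormalization group approach to lattice gauge field theories. I*, Commun. Math.
Phys. **109** (1987) 249–301 (`Balaban1987RG1`, "B12"), p. 291 [PDF 43] and p. 292 [PDF 44] (held:
`lit read paper:balaban1987-cmp109-rg-i-small-field --pages 43-44`); T. Bałaban, *Propagators and
renormalization transformations for lattice gauge theories. I*, Commun. Math. Phys. **95** (1984) 17–40
(`Balaban1984PropagatorsI`, "B5" = B12's reference [10]), (1.29) p. 23 (momentum representation), (1.66) p. 29.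
PDF held: yes (both).  Unit `lit-balaban` (HOME `run/shared/lean/pub/lit-balaban/`), Phase-2 proof seat p10
(gen 7, file 2/2); WHAT IS REPRODUCED = SKELETON row `B12.Eq4.42-4.45`, members (4.43) and (4.45) — their FIRST
equality signs — for the typed symbol `B12Eq441SymbolExpansion.symbDeltaJ` (row `B12.Eq4.41`).

## What the paper prints (verbatim, B12 pp. 291–292)

p. 291: «The function Δ_{j,μν}(x − y) in the momentum representation of (1.66) has the following expansion around 0:
  Δ̃_{j,μν}(p′) = Δ₀(p′)δ_{μν} − ∂¹_μ(p′)∂¹_ν(p′)* + (terms of higher order in p′),   (4.41)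
see (1.29)–(1.37) [10] for an explanation of symbols used in connection with momentum representations. […]
In the second term we have the expression
  β_j(g_{j−1}) Σ_y Δ_{j,μν}(x − y)(y_κ − x_κ)(y_λ − x_λ) = −β_j(g_{j−1})((∂²/∂p′_κ∂p′_λ)Δ̃_{j,μν})(0)
  = β_j(g_{j−1})(δ_{μκ}δ_{νλ} + δ_{μλ}δ_{νκ} − 2δ_{μν}δ_{κλ}).   (4.43)»
p. 292: «In the third term we have the expression
  β_j(g_{j−1}) Σ_y Δ_{k,μν}(x − y)(y_κ − x_κ) = β_j(g_{j−1})((1/i)(∂/∂p′_κ)Δ̃_{j,μν})(0) = 0,   (4.45)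
hence this term vanishes.»  (sic «Δ_{k,μν}»; read `Δ_{j,μν}`.)

## What this module proves (kernel-checked; every `n = L^j ≥ 1`, every dimension `d + 1 ≥ 1`, all `μ ν κ λ`)

Dictionary (the tree's, `B4ContourShift` / `B4TorusKernel`, [B5] (1.29)): the kernel of the translation-invariant
operator with symbol `G(p′)` on the unit lattice `ℤ^{d+1}` is `K(x) = (2π)^{-(d+1)} ∫_{[-π,π]^{d+1}} G(p′) e^{ip′·x} dp′ =
B4ContourShift.latticeKernel G x`, so that `(Kf)(x) = Σ_y K(x − y) f(y)` and `G(p′) = Σ_x K(x) e^{−ip′·x}`.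
* §1 `stripRegular_symbC`: the holomorphic continuation `symbC n μ ν` of the entry `Δ̃_{j,μν}` (file 1,
  `B12Eq443SymbolHessian.symbC`, `= Δ̃_{j,μν}` on real momenta by `symbC_ofReal`) is STRIP REGULAR
  (`B4ContourShift.StripRegular`: continuous and bounded on the closed strip `|Im p_i| ≤ κ₁₆₆(d+1)` around the
  Brillouin zone, slice-holomorphic, `2π`-periodic across the faces) — from `B5Symbol166Strip.stripRegular_W166 /
  stripRegular_expFacNeg / stripRegular_expFacPos` (unit `b2b-balaban-b05`).
* §2 `kerDeltaJ n μ ν x := latticeKernel (symbC n μ ν) x` = `Δ_{j,μν}(x)`, `x ∈ ℤ^{d+1}`; `kerDeltaJ_eq_integral`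
  (it is `(2π)^{-(d+1)}∫_{BZ} Δ̃_{j,μν}(p′)e^{ip′·x}dp′` with the TYPED symbol); `norm_kerDeltaJ_le` (exponential decay
  `‖Δ_{j,μν}(x)‖ ≤ M e^{−κ₁₆₆|x|_∞}`, the tree's Paley–Wiener engine `B4ContourShift.latticeKernel_decay`); absolute
  summability of `Δ_{j,μν}(x)`, `|x|_∞Δ_{j,μν}(x)`, `|x|_∞²Δ_{j,μν}(x)`.
* §3 **`hasSum_kerDeltaJ_phase`** (Fourier inversion = the momentum representation): for every `p′` of the open zone
  `|p′_i| < π`, `Σ_{x ∈ ℤ^{d+1}} Δ_{j,μν}(x) e^{−ip′·x} = Δ̃_{j,μν}(p′)` (absolutely convergent) — Mathlib's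
  `UnitAddTorus.hasSum_mFourier_series_apply_of_summable` through the tree's descent `B4TorusKernel.descendC /
  mFourierCoeff_descend / descend_coe`.
* §4 termwise differentiation along rays `t ↦ Δ̃_{j,μν}(tw)` (Mathlib `hasDerivAt_tsum`, dominated by §2), and
  identification with the file-1 derivatives (`hasFDerivAt_symbDeltaJ`, `fderiv_symbDeltaJ_zero`, `hess`):
  **`hasSum_kerDeltaJ_mul_phase`** `Σ_x Δ_{j,μν}(x)(w·x) = i·DΔ̃_{j,μν}(0)w` and
  **`hasSum_kerDeltaJ_mul_phase_mul_phase`** `Σ_x Δ_{j,μν}(x)(v·x)(w·x) = −D²Δ̃_{j,μν}(0)(v,w)`.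
* §5 THE PRINTED DISPLAYS, first «=» and the whole chain: **`eq445_first`** `Σ_y Δ_{j,μν}(x−y)(y_κ − x_κ) =
  ((1/i)∂_κΔ̃_{j,μν})(0)`, **`eq445`** `… = 0`; **`eq443_first`** `Σ_y Δ_{j,μν}(x−y)(y_κ−x_κ)(y_λ−x_λ) =
  −(∂_κ∂_λΔ̃_{j,μν})(0)` (`= −hess n μ ν e_κ e_λ`), **`eq443`** `… = δ_{μκ}δ_{νλ} + δ_{μλ}δ_{νκ} − 2δ_{μν}δ_{κλ}`
  (second «=» = file 1's `hess_eDir`), `eq443_kdA` (the same in the shape of the hypothesis `hM2` of the tree's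
  (4.43) ⇒ (4.44) algebra `B12Marginal444.block2_of_moments443`, `β = 1`); coordinate-moment forms
  `tsum_coord_mul_kerDeltaJ` (`Σ_x x_κΔ_{j,μν}(x) = 0`), `tsum_coord_mul_coord_mul_kerDeltaJ`.

## What is NOT claimed

(1) The sums `Σ_y` here run over the INFINITE unit lattice `ℤ^{d+1}` (the kernel of the symbol on `ℓ²(ℤ^{d+1})`),
where the displayed identities are exact; on Bałaban's torus `T` the operator `Δ_j` of (4.40) has the PERIODISED
kernel (`B4TorusKernel.torusKernel_descend_eq`: `Σ_m K(x + Nm)`, with `B4TorusKernel.torusKernel_descend_decay`), and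
the torus reading of `Σ_{y ∈ T}` with centred representatives `y − x` differs from the `ℤ^{d+1}` sums by
periodisation tails — that torus bookkeeping is not typed here, nor is the finite-`Y` instantiation of
`B12Marginal444.block2_of_moments443 / block3_eq_zero_of_moments445`.  (2) As in file 1 and in
`B12Eq441SymbolExpansion`: `Δ̃_j` is the symbol OF THE PRINTED FORMULA (1.66) [10] (`U = 1`, `m² = 0`); (1.65) = (1.66)
is row B5.Eq1.66's business.  Nothing here is progress on a summit; value = kernel certificate that, for the typed
`Δ_j`, the lattice moments printed on the left of (4.43)/(4.45) converge absolutely and equal the printed derivatives,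
uniformly in the scale `j`.
-/

noncomputable section

namespace Literature.MathematicalPhysics.QuantumFieldTheory.Balaban1983to89.B12Eq443LatticeMoments

open scoped BigOperators Topology Real
open Finset Complex Filter
open Literature.MathematicalPhysics.QuantumFieldTheory.Balaban1983to89.B4Strip (ofRealVec Strip)
open Literature.MathematicalPhysics.QuantumFieldTheory.Balaban1983to89.B4StripCauchy
open Literature.MathematicalPhysics.QuantumFieldTheory.Balaban1983to89.B4ContourShift
open Literature.MathematicalPhysics.QuantumFieldTheory.Balaban1983to89.B4TorusKernel
open Literature.MathematicalPhysics.QuantumFieldTheory.Balaban1983to89.B5Strip145Analytic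
open Literature.MathematicalPhysics.QuantumFieldTheory.Balaban1983to89.B5Symbol166
open Literature.MathematicalPhysics.QuantumFieldTheory.Balaban1983to89.B5Symbol166Strip
open Literature.MathematicalPhysics.QuantumFieldTheory.Balaban1983to89.B12Eq441SymbolExpansion
open Literature.MathematicalPhysics.QuantumFieldTheory.Balaban1983to89.B12Eq443SymbolHessian

variable {d : ℕ}

/-! ## §1. Strip regularity of the continued entries `Δ̃ᶜ_{j,μν}` -/

/-- negatives of strip-regular symbols are strip regular, same bound. [folklore] -/
private theorem stripRegular_neg {G : (Fin (d + 1) → ℂ) → ℂ} {κ M : ℝ} (h : StripRegular G κ M) :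
    StripRegular (fun p => -G p) κ M := by
  refine ⟨h.cont.neg, fun i q hq => (h.diff i q hq).neg, ?_, ?_⟩
  · intro i q hq y hy
    show -G _ = -G _
    rw [h.sides i q hq y hy]
  · intro p hp
    rw [norm_neg]
    exact h.bound p hp

/-- finite sums of strip-regular symbols are strip regular, with the sum of the bounds. [folklore] -/
private theorem stripRegular_sum {ι : Type*} (s : Finset ι) (G : ι → (Fin (d + 1) → ℂ) → ℂ) (M : ι → ℝ)
    {κ : ℝ} (h : ∀ i ∈ s, StripRegular (G i) κ (M i)) :
    StripRegular (fun p => ∑ i ∈ s, G i p) κ (∑ i ∈ s, M i) := by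
  classical
  induction s using Finset.induction_on with
  | empty => simpa using stripRegular_const (d := d) (0 : ℂ) κ
  | insert a s ha ih =>
    have h1 := h a (Finset.mem_insert_self a s)
    have h2 := ih (fun i hi => h i (Finset.mem_insert_of_mem hi))
    have h12 := h1.add h2
    simpa [Finset.sum_insert ha] using h12

/-- an explicit strip bound for the continued entries: `(d)·MW(d)·(e^κ + 1)²` (`d` summands at most, each
`|W| ≤ MW`, `|e^{∓ip_a} − 1| ≤ e^κ + 1`). [folklore] -/
def MC (d : ℕ) (κ : ℝ) : ℝ := d * (MW d * ((Real.exp κ + 1) * (Real.exp κ + 1)))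

/-- `0 ≤ MC`. [folklore] -/
private theorem MC_nonneg (d : ℕ) (κ : ℝ) : 0 ≤ MC d κ := by
  unfold MC; have := MW_pos d; positivity

/-- **strip regularity of the continued entries**: `Δ̃ᶜ_{j,μν} = symbC n μ ν` is strip regular on the closed strip of
half-width `κ`, `0 ≤ κ ≤ κ₁₆₆(d+1)`, with bound `MC (d+1) κ`, for every `n ≥ 1` and all `μ, ν`.
[cite: Balaban1987RG1, (4.41) p.291] -/
theorem stripRegular_symbC (n : ℕ) [NeZero n] (μ ν : Fin (d + 1)) {κ : ℝ} (hκ0 : 0 ≤ κ)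
    (hκ : κ ≤ kappa166 (d + 1)) : StripRegular (d := d) (symbC n μ ν) κ (MC (d + 1) κ) := by
  have hE : ∀ a b : Fin (d + 1), StripRegular (d := d) (fun p => expFacNeg a p * expFacPos b p) κ
      ((Real.exp κ + 1) * (Real.exp κ + 1)) :=
    fun a b => (stripRegular_expFacNeg (d := d) a κ).mul (stripRegular_expFacPos (d := d) b κ) (by positivity)
  have hP : ∀ a b : Fin (d + 1), a ≠ b → StripRegular (d := d)
      (fun p => W166 n a b p * (expFacNeg a p * expFacPos b p)) κ
      (MW (d + 1) * ((Real.exp κ + 1) * (Real.exp κ + 1))) :=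
    fun a b hab => (stripRegular_W166 (d := d) n hκ0 hκ hab).mul (hE a b) (MW_pos _).le
  have hM0 : 0 ≤ MW (d + 1) * ((Real.exp κ + 1) * (Real.exp κ + 1)) := by
    have := MW_pos (d + 1); positivity
  by_cases hμν : μ = ν
  · subst hμν
    have e : symbC n μ μ = fun p => ∑ κ' ∈ univ.erase μ, W166 n κ' μ p * (expFacNeg κ' p * expFacPos κ' p) := by
      funext p; simp [symbC]
    rw [e]
    have hdiag : ∀ a : Fin (d + 1), a ≠ μ → StripRegular (d := d)
        (fun p => W166 n a μ p * (expFacNeg a p * expFacPos a p)) κ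
        (MW (d + 1) * ((Real.exp κ + 1) * (Real.exp κ + 1))) :=
      fun a ha => (stripRegular_W166 (d := d) n hκ0 hκ ha).mul (hE a a) (MW_pos _).le
    have hs := stripRegular_sum (univ.erase μ) (fun a p => W166 n a μ p * (expFacNeg a p * expFacPos a p))
      (fun _ => MW (d + 1) * ((Real.exp κ + 1) * (Real.exp κ + 1)))
      (fun a ha => hdiag a (Finset.ne_of_mem_erase ha))
    refine hs.mono ?_
    rw [Finset.sum_const, Finset.card_erase_of_mem (Finset.mem_univ μ), Finset.card_univ, Fintype.card_fin,
      nsmul_eq_mul]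
    unfold MC
    push_cast
    gcongr
    linarith
  · have e : symbC n μ ν = fun p => -(W166 n μ ν p * (expFacNeg μ p * expFacPos ν p)) := by
      funext p; simp [symbC, hμν]
    rw [e]
    refine (stripRegular_neg (hP μ ν hμν)).mono ?_
    unfold MC
    have h1 : (1 : ℝ) ≤ ((d + 1 : ℕ) : ℝ) := by exact_mod_cast Nat.succ_le_succ (Nat.zero_le d)
    nlinarith

/-! ## §2. The lattice kernel `Δ_{j,μν}(x)`, `x ∈ ℤ^{d+1}`: integral formula, decay, weighted summability -/

/-- **the kernel of `Δ_j`**: `Δ_{j,μν}(x) := (2π)^{-(d+1)} ∫_{[-π,π]^{d+1}} Δ̃_{j,μν}(p′) e^{ip′·x} dp′`, `x ∈ ℤ^{d+1}` —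
the kernel (at `(x, 0)`, by translation invariance `Δ_{j,μν}(x − y)` at `(x, y)`) of the operator on the unit lattice
whose momentum representation is the typed symbol `Δ̃_{j,μν}` ([B5] (1.29) dictionary = the tree's
`B4ContourShift.latticeKernel`, applied to the continuation `symbC`, which on the zone IS `Δ̃_{j,μν}`).
[cite: Balaban1987RG1, (4.40)–(4.41) p.291] -/
def kerDeltaJ (n : ℕ) [NeZero n] (μ ν : Fin (d + 1)) (x : Fin (d + 1) → ℤ) : ℂ :=
  latticeKernel (symbC n μ ν) x

/-- the kernel is the Brillouin-zone integral of the TYPED symbol against `e^{ip′·x}`: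
`Δ_{j,μν}(x) = (2π)^{-(d+1)} ∫_{[-π,π]^{d+1}} Δ̃_{j,μν}(p′) e^{ip′·x} dp′`. [cite: Balaban1987RG1, (4.41) p.291] -/
theorem kerDeltaJ_eq_integral (n : ℕ) [NeZero n] (μ ν : Fin (d + 1)) (x : Fin (d + 1) → ℤ) :
    kerDeltaJ n μ ν x = (((2 * π) ^ (d + 1))⁻¹ : ℝ) •
      ∫ p in BZ (d + 1), symbDeltaJ n p μ ν * cexp (I * phase p x) := by
  unfold kerDeltaJ latticeKernel fourierBox
  congr 1
  refine MeasureTheory.setIntegral_congr_fun measurableSet_Icc (fun p hp => ?_)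
  have hp' : ∀ κ, |p κ| ≤ Real.pi := fun κ => abs_le.mpr ⟨hp.1 κ, hp.2 κ⟩
  simp only [integrand, symbC_ofReal n μ ν p hp']

section Kernel

variable (n : ℕ) [NeZero n] (μ ν : Fin (d + 1))

/-- the strip datum used throughout: half-width `κ₁₆₆(d+1) > 0`. [folklore] -/
private theorem reg : StripRegular (d := d) (symbC n μ ν) (kappa166 (d + 1)) (MC (d + 1) (kappa166 (d + 1))) :=
  stripRegular_symbC n μ ν (kappa166_pos _).le le_rfl

/-- **exponential decay of the kernel**: `‖Δ_{j,μν}(x)‖ ≤ MC · e^{−κ₁₆₆(d+1)|x|_∞}` (Paley–Wiener on the strip,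
`B4ContourShift.latticeKernel_decay`), every `n ≥ 1`. [cite: Balaban1987RG1, (4.41) p.291] -/
theorem norm_kerDeltaJ_le (x : Fin (d + 1) → ℤ) :
    ‖kerDeltaJ n μ ν x‖ ≤ MC (d + 1) (kappa166 (d + 1)) * Real.exp (-(kappa166 (d + 1) * supNorm x)) :=
  latticeKernel_decay (reg n μ ν) (kappa166_pos _).le x

/-- the kernel is absolutely summable over `ℤ^{d+1}`. [cite: Balaban1987RG1, (4.41) p.291] -/
theorem summable_kerDeltaJ : Summable (kerDeltaJ n μ ν) :=
  summable_of_decay _ (kappa166_pos _) (norm_kerDeltaJ_le n μ ν)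

/-- a coordinate is at most the sup norm. [folklore] -/
private theorem abs_coord_le_supNorm (x : Fin (d + 1) → ℤ) (i : Fin (d + 1)) : |((x i : ℤ) : ℝ)| ≤ supNorm x := by
  have h := abs_le_supNorm x i
  push_cast at h
  exact h

/-- `s e^{−κs} ≤ (2/κ) e^{−κs/2}` (all real `s`). [folklore] -/
private theorem mul_exp_le {κ : ℝ} (hκ : 0 < κ) (s : ℝ) :
    s * Real.exp (-(κ * s)) ≤ 2 / κ * Real.exp (-(κ / 2 * s)) := by
  have h2 : s ≤ 2 / κ * Real.exp (κ / 2 * s) := by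
    rw [div_mul_eq_mul_div, le_div_iff₀ hκ]
    nlinarith [Real.add_one_le_exp (κ / 2 * s)]
  calc s * Real.exp (-(κ * s)) ≤ 2 / κ * Real.exp (κ / 2 * s) * Real.exp (-(κ * s)) := by gcongr
    _ = 2 / κ * Real.exp (-(κ / 2 * s)) := by
        rw [mul_assoc, ← Real.exp_add]
        congr 2
        ring

/-- `s² e^{−κs} ≤ (4/κ)² e^{−κs/2}` for `s ≥ 0`. [folklore] -/
private theorem sq_mul_exp_le {κ s : ℝ} (hκ : 0 < κ) (hs : 0 ≤ s) :
    s ^ 2 * Real.exp (-(κ * s)) ≤ (4 / κ) ^ 2 * Real.exp (-(κ / 2 * s)) := by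
  have h2 : s ≤ 4 / κ * Real.exp (κ / 4 * s) := by
    rw [div_mul_eq_mul_div, le_div_iff₀ hκ]
    nlinarith [Real.add_one_le_exp (κ / 4 * s)]
  have h3 : s ^ 2 ≤ (4 / κ * Real.exp (κ / 4 * s)) ^ 2 := pow_le_pow_left₀ hs h2 2
  calc s ^ 2 * Real.exp (-(κ * s)) ≤ (4 / κ * Real.exp (κ / 4 * s)) ^ 2 * Real.exp (-(κ * s)) := by gcongr
    _ = (4 / κ) ^ 2 * (Real.exp (κ / 4 * s) * Real.exp (κ / 4 * s) * Real.exp (-(κ * s))) := by ring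
    _ = (4 / κ) ^ 2 * Real.exp (-(κ / 2 * s)) := by
        rw [← Real.exp_add, ← Real.exp_add]
        congr 2
        ring

/-- exponentially decaying real sequences on `ℤ^{d+1}` are summable. [folklore] -/
private theorem summable_exp_decay {κ : ℝ} (hκ : 0 < κ) (C : ℝ) :
    Summable (fun x : Fin (d + 1) → ℤ => C * Real.exp (-(κ * supNorm x))) := by
  have h := summable_of_decay (fun x : Fin (d + 1) → ℤ => (((C * Real.exp (-(κ * supNorm x)) : ℝ)) : ℂ)) hκ
    (M := |C|) (fun x => by
      rw [Complex.norm_real, Real.norm_eq_abs, abs_mul, abs_of_pos (Real.exp_pos _)])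
  exact Complex.summable_ofReal.mp h

/-- the first absolute moment converges: `Σ_x |x|_∞ ‖Δ_{j,μν}(x)‖ < ∞`. [cite: Balaban1987RG1, (4.45) p.292] -/
theorem summable_supNorm_mul_norm_kerDeltaJ : Summable (fun x => supNorm x * ‖kerDeltaJ n μ ν x‖) := by
  set κ := kappa166 (d + 1) with hκdef
  set M := MC (d + 1) κ with hMdef
  have hκ : 0 < κ := kappa166_pos _
  have hM : 0 ≤ M := MC_nonneg _ _
  refine Summable.of_norm_bounded (summable_exp_decay (half_pos hκ) (M * (2 / κ))) (fun x => ?_)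
  rw [Real.norm_of_nonneg (mul_nonneg (supNorm_nonneg x) (norm_nonneg _))]
  calc supNorm x * ‖kerDeltaJ n μ ν x‖ ≤ supNorm x * (M * Real.exp (-(κ * supNorm x))) := by
        gcongr
        · exact supNorm_nonneg x
        · exact norm_kerDeltaJ_le n μ ν x
    _ = M * (supNorm x * Real.exp (-(κ * supNorm x))) := by ring
    _ ≤ M * (2 / κ * Real.exp (-(κ / 2 * supNorm x))) :=
        mul_le_mul_of_nonneg_left (mul_exp_le hκ (supNorm x)) hM
    _ = M * (2 / κ) * Real.exp (-(κ / 2 * supNorm x)) := by ring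

/-- the second absolute moment converges: `Σ_x |x|_∞² ‖Δ_{j,μν}(x)‖ < ∞`. [cite: Balaban1987RG1, (4.43) p.291] -/
theorem summable_supNorm_sq_mul_norm_kerDeltaJ : Summable (fun x => supNorm x ^ 2 * ‖kerDeltaJ n μ ν x‖) := by
  set κ := kappa166 (d + 1) with hκdef
  set M := MC (d + 1) κ with hMdef
  have hκ : 0 < κ := kappa166_pos _
  have hM : 0 ≤ M := MC_nonneg _ _
  refine Summable.of_norm_bounded (summable_exp_decay (half_pos hκ) (M * (4 / κ) ^ 2)) (fun x => ?_)
  rw [Real.norm_of_nonneg (mul_nonneg (pow_nonneg (supNorm_nonneg x) 2) (norm_nonneg _))]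
  calc supNorm x ^ 2 * ‖kerDeltaJ n μ ν x‖ ≤ supNorm x ^ 2 * (M * Real.exp (-(κ * supNorm x))) := by
        gcongr
        exact norm_kerDeltaJ_le n μ ν x
    _ = M * (supNorm x ^ 2 * Real.exp (-(κ * supNorm x))) := by ring
    _ ≤ M * ((4 / κ) ^ 2 * Real.exp (-(κ / 2 * supNorm x))) :=
        mul_le_mul_of_nonneg_left (sq_mul_exp_le hκ (supNorm_nonneg x)) hM
    _ = M * (4 / κ) ^ 2 * Real.exp (-(κ / 2 * supNorm x)) := by ring

/-! ## §3. Fourier inversion on the open zone: `Σ_x Δ_{j,μν}(x) e^{−ip′·x} = Δ̃_{j,μν}(p′)` -/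

/-- the phase is odd in the lattice point. [folklore] -/
private theorem phase_neg (p : Fin (d + 1) → ℝ) (x : Fin (d + 1) → ℤ) : phase p (-x) = -phase p x := by
  simp [phase, Finset.sum_neg_distrib, mul_neg]

/-- a point of the open zone, scaled by `1/2π`, lies in the closed unit box. [folklore] -/
private theorem div_two_pi_mem_unitBox {p : Fin (d + 1) → ℝ} (hp : p ∈ zone (d + 1)) :
    (fun i => p i / (2 * π)) ∈ unitBox d := by
  have h2π : 0 < 2 * π := by positivity
  refine ⟨fun i => ?_, fun i => ?_⟩
  · have h := (abs_lt.mp (hp i)).1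
    show -(1 / 2 : ℝ) ≤ p i / (2 * π)
    rw [le_div_iff₀ h2π]
    linarith
  · have h := (abs_lt.mp (hp i)).2
    show p i / (2 * π) ≤ 1 / 2
    rw [div_le_iff₀ h2π]
    linarith

/-- **Fourier inversion = the momentum representation of `Δ_j`** ([B5] (1.29)–(1.37)): for every `p′` of the open
Brillouin zone `|p′_i| < π` the absolutely convergent lattice sum `Σ_{x ∈ ℤ^{d+1}} Δ_{j,μν}(x) e^{−ip′·x}` equals the
typed symbol `Δ̃_{j,μν}(p′)` — every `n = L^j ≥ 1`, all `μ, ν` (Mathlib's Fourier series on `(ℝ/ℤ)^{d+1}` for the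
descent `B4TorusKernel.descendC` of the strip-regular continuation, whose coefficients ARE the lattice kernel,
`B4TorusKernel.mFourierCoeff_descend`). [cite: Balaban1987RG1, (4.41) p.291] -/
theorem hasSum_kerDeltaJ_phase (p : Fin (d + 1) → ℝ) (hp : p ∈ zone (d + 1)) :
    HasSum (fun x : Fin (d + 1) → ℤ => kerDeltaJ n μ ν x * cexp (-(I * phase p x))) (symbDeltaJ n p μ ν) := by
  have hκ : (0 : ℝ) ≤ kappa166 (d + 1) := (kappa166_pos _).le
  set f := descendC (symbC n μ ν) (reg n μ ν) hκ with hf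
  have hsum : Summable (UnitAddTorus.mFourierCoeff f) :=
    summable_of_decay _ (kappa166_pos _) (norm_mFourierCoeff_descend_le (reg n μ ν) hκ)
  set s : Fin (d + 1) → ℝ := fun i => p i / (2 * π) with hs
  have hsbox : s ∈ unitBox d := div_two_pi_mem_unitBox hp
  have h2πs : (fun i => 2 * π * s i) = p := by
    funext i
    simp only [hs]
    field_simp
  have h2πs' : (2 * π) • s = p := by
    rw [← h2πs]
    funext i
    simp [Pi.smul_apply, smul_eq_mul]
  have h1 := UnitAddTorus.hasSum_mFourier_series_apply_of_summable hsum (fun i => ((s i : ℝ) : UnitAddCircle))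
  have hval : f (fun i => ((s i : ℝ) : UnitAddCircle)) = symbDeltaJ n p μ ν := by
    rw [hf, descendC_apply, descend_coe (reg n μ ν) hκ hsbox, h2πs, symbC_ofReal n μ ν p (fun κ => (hp κ).le)]
  have hterm : ∀ i : Fin (d + 1) → ℤ,
      UnitAddTorus.mFourierCoeff f i • UnitAddTorus.mFourier i (fun j => ((s j : ℝ) : UnitAddCircle))
        = kerDeltaJ n μ ν (-i) * cexp (I * phase p i) := by
    intro i
    rw [hf, mFourierCoeff_descend (reg n μ ν) hκ i, mFourier_coe_eq, smul_eq_mul, h2πs']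
    rfl
  rw [hval] at h1
  simp_rw [hterm] at h1
  have h2 := (Equiv.neg (Fin (d + 1) → ℤ)).hasSum_iff.mpr h1
  convert h2 using 1
  funext x
  simp [phase_neg]

/-! ## §4. Termwise differentiation along rays `t ↦ Δ̃_{j,μν}(tw)`; moments = derivatives at `0` -/

/-- the phase is linear in the momentum: `(tw)·x = t(w·x)`. [folklore] -/
private theorem phase_smul (t : ℝ) (w : Fin (d + 1) → ℝ) (x : Fin (d + 1) → ℤ) :
    phase (t • w) x = (t : ℂ) * phase w x := by
  simp only [phase, Pi.smul_apply, smul_eq_mul, Complex.ofReal_mul, Finset.mul_sum, mul_assoc]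

/-- the phase is additive in the momentum. [folklore] -/
private theorem phase_add (v w : Fin (d + 1) → ℝ) (x : Fin (d + 1) → ℤ) :
    phase (v + w) x = phase v x + phase w x := by
  simp only [phase, Pi.add_apply, Complex.ofReal_add, add_mul, Finset.sum_add_distrib]

/-- the coordinate phase: `e_κ·x = x_κ`. [folklore] -/
private theorem phase_eDir (κ : Fin (d + 1)) (x : Fin (d + 1) → ℤ) : phase (eDir κ) x = ((x κ : ℤ) : ℂ) := by
  rw [phase, Finset.sum_eq_single κ (fun μ _ hμ => by simp [eDir, Pi.single_eq_of_ne hμ])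
    (fun h => absurd (Finset.mem_univ κ) h)]
  simp [eDir]

/-- the ray exponent `−i(w·x)` (so that `e^{−i(tw)·x} = e^{t·coef}`). [folklore] -/
private def coef (w : Fin (d + 1) → ℝ) (x : Fin (d + 1) → ℤ) : ℂ := -(I * phase w x)

/-- the exponent is purely imaginary. [folklore] -/
private theorem coef_eq (w : Fin (d + 1) → ℝ) (x : Fin (d + 1) → ℤ) :
    coef w x = ((-(∑ j, w j * (x j : ℝ)) : ℝ) : ℂ) * I := by
  rw [coef, phase_eq_ofReal]; push_cast; ring

/-- the ray phase factors are unimodular. [folklore] -/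
private theorem norm_cexp_coef (w : Fin (d + 1) → ℝ) (x : Fin (d + 1) → ℤ) (t : ℝ) :
    ‖cexp ((t : ℂ) * coef w x)‖ = 1 := by
  rw [coef_eq, ← mul_assoc, ← Complex.ofReal_mul, Complex.norm_exp_ofReal_mul_I]

/-- `|w·x| ≤ (d+1)‖w‖∞|x|_∞`. [folklore] -/
private theorem norm_coef_le (w : Fin (d + 1) → ℝ) (x : Fin (d + 1) → ℤ) :
    ‖coef w x‖ ≤ ((d : ℝ) + 1) * ‖w‖ * supNorm x := by
  rw [coef_eq, norm_mul, Complex.norm_I, mul_one, Complex.norm_real, Real.norm_eq_abs, abs_neg]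
  calc |∑ j, w j * (x j : ℝ)| ≤ ∑ j, |w j * (x j : ℝ)| := Finset.abs_sum_le_sum_abs _ _
    _ ≤ ∑ _j : Fin (d + 1), ‖w‖ * supNorm x := Finset.sum_le_sum fun j _ => by
        rw [abs_mul]
        have hw : |w j| ≤ ‖w‖ := by simpa [Real.norm_eq_abs] using norm_le_pi_norm w j
        exact mul_le_mul hw (abs_coord_le_supNorm x j) (abs_nonneg _) (norm_nonneg _)
    _ = ((d : ℝ) + 1) * ‖w‖ * supNorm x := by
        rw [Finset.sum_const, Finset.card_univ, Fintype.card_fin, nsmul_eq_mul]; push_cast; ring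

/-- the terms of the ray series `Σ_x Δ_{j,μν}(x) e^{−it(w·x)}`. [folklore] -/
private def g0 (w : Fin (d + 1) → ℝ) (x : Fin (d + 1) → ℤ) (t : ℝ) : ℂ :=
  kerDeltaJ n μ ν x * cexp ((t : ℂ) * coef w x)

/-- their `t`-derivatives. [folklore] -/
private def g1 (w : Fin (d + 1) → ℝ) (x : Fin (d + 1) → ℤ) (t : ℝ) : ℂ :=
  kerDeltaJ n μ ν x * (cexp ((t : ℂ) * coef w x) * coef w x)

/-- their second `t`-derivatives. [folklore] -/
private def g2 (w : Fin (d + 1) → ℝ) (x : Fin (d + 1) → ℤ) (t : ℝ) : ℂ :=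
  kerDeltaJ n μ ν x * (cexp ((t : ℂ) * coef w x) * coef w x * coef w x)

/-- `d/dt (t·c) = c`. [folklore] -/
private theorem hasDerivAt_lin (c : ℂ) (t : ℝ) : HasDerivAt (fun t : ℝ => (t : ℂ) * c) c t := by
  simpa using ((hasDerivAt_id t).ofReal_comp).mul_const c

/-- `g0′ = g1`. [folklore] -/
private theorem hasDerivAt_g0 (w : Fin (d + 1) → ℝ) (x : Fin (d + 1) → ℤ) (t : ℝ) :
    HasDerivAt (g0 n μ ν w x) (g1 n μ ν w x t) t :=
  ((hasDerivAt_lin (coef w x) t).cexp).const_mul _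

/-- `g1′ = g2`. [folklore] -/
private theorem hasDerivAt_g1 (w : Fin (d + 1) → ℝ) (x : Fin (d + 1) → ℤ) (t : ℝ) :
    HasDerivAt (g1 n μ ν w x) (g2 n μ ν w x t) t :=
  (((hasDerivAt_lin (coef w x) t).cexp).mul_const (coef w x)).const_mul _

/-- domination of the first derivatives: `‖g1‖ ≤ (d+1)‖w‖·|x|_∞‖Δ_{j,μν}(x)‖`. [folklore] -/
private theorem norm_g1_le (w : Fin (d + 1) → ℝ) (x : Fin (d + 1) → ℤ) (t : ℝ) :
    ‖g1 n μ ν w x t‖ ≤ ((d : ℝ) + 1) * ‖w‖ * (supNorm x * ‖kerDeltaJ n μ ν x‖) := by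
  unfold g1
  rw [norm_mul, norm_mul, norm_cexp_coef, one_mul]
  calc ‖kerDeltaJ n μ ν x‖ * ‖coef w x‖ ≤ ‖kerDeltaJ n μ ν x‖ * (((d : ℝ) + 1) * ‖w‖ * supNorm x) :=
        mul_le_mul_of_nonneg_left (norm_coef_le w x) (norm_nonneg _)
    _ = ((d : ℝ) + 1) * ‖w‖ * (supNorm x * ‖kerDeltaJ n μ ν x‖) := by ring

/-- domination of the second derivatives: `‖g2‖ ≤ ((d+1)‖w‖)²·|x|_∞²‖Δ_{j,μν}(x)‖`. [folklore] -/
private theorem norm_g2_le (w : Fin (d + 1) → ℝ) (x : Fin (d + 1) → ℤ) (t : ℝ) :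
    ‖g2 n μ ν w x t‖ ≤ (((d : ℝ) + 1) * ‖w‖) ^ 2 * (supNorm x ^ 2 * ‖kerDeltaJ n μ ν x‖) := by
  unfold g2
  rw [norm_mul, norm_mul, norm_mul, norm_cexp_coef, one_mul]
  have h := norm_coef_le w x
  have h0 : 0 ≤ ‖coef w x‖ := norm_nonneg _
  calc ‖kerDeltaJ n μ ν x‖ * (‖coef w x‖ * ‖coef w x‖)
      ≤ ‖kerDeltaJ n μ ν x‖ * ((((d : ℝ) + 1) * ‖w‖ * supNorm x) * (((d : ℝ) + 1) * ‖w‖ * supNorm x)) :=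
        mul_le_mul_of_nonneg_left (mul_le_mul h h h0 (h0.trans h)) (norm_nonneg _)
    _ = (((d : ℝ) + 1) * ‖w‖) ^ 2 * (supNorm x ^ 2 * ‖kerDeltaJ n μ ν x‖) := by ring

/-- **termwise differentiation, first order**: the ray series `F_w(t) = Σ_x Δ_{j,μν}(x)e^{−it(w·x)}` is
differentiable on `ℝ` with derivative `Σ_x g1` (Mathlib `hasDerivAt_tsum`, dominated by the first absolute moment).
[folklore] -/
private theorem hasDerivAt_F0 (w : Fin (d + 1) → ℝ) (t : ℝ) :
    HasDerivAt (fun t => ∑' x, g0 n μ ν w x t) (∑' x, g1 n μ ν w x t) t := by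
  refine hasDerivAt_tsum (u := fun x => ((d : ℝ) + 1) * ‖w‖ * (supNorm x * ‖kerDeltaJ n μ ν x‖))
    ((summable_supNorm_mul_norm_kerDeltaJ n μ ν).mul_left _) (fun x t => hasDerivAt_g0 n μ ν w x t)
    (fun x t => norm_g1_le n μ ν w x t) (y₀ := 0) ?_ t
  simpa [g0] using summable_kerDeltaJ n μ ν

/-- the first termwise derivatives are summable at `t = 0`. [folklore] -/
private theorem summable_g1_zero (w : Fin (d + 1) → ℝ) : Summable (fun x => g1 n μ ν w x 0) :=
  Summable.of_norm_bounded ((summable_supNorm_mul_norm_kerDeltaJ n μ ν).mul_left _)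
    (fun x => norm_g1_le n μ ν w x 0)

/-- the second termwise derivatives are summable at `t = 0`. [folklore] -/
private theorem summable_g2_zero (w : Fin (d + 1) → ℝ) : Summable (fun x => g2 n μ ν w x 0) :=
  Summable.of_norm_bounded ((summable_supNorm_sq_mul_norm_kerDeltaJ n μ ν).mul_left _)
    (fun x => norm_g2_le n μ ν w x 0)

/-- **termwise differentiation, second order**: `Σ_x g1` is differentiable on `ℝ` with derivative `Σ_x g2`
(dominated by the second absolute moment). [folklore] -/
private theorem hasDerivAt_F1 (w : Fin (d + 1) → ℝ) (t : ℝ) :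
    HasDerivAt (fun t => ∑' x, g1 n μ ν w x t) (∑' x, g2 n μ ν w x t) t :=
  hasDerivAt_tsum (u := fun x => (((d : ℝ) + 1) * ‖w‖) ^ 2 * (supNorm x ^ 2 * ‖kerDeltaJ n μ ν x‖))
    ((summable_supNorm_sq_mul_norm_kerDeltaJ n μ ν).mul_left _) (fun x t => hasDerivAt_g1 n μ ν w x t)
    (fun x t => norm_g2_le n μ ν w x t) (y₀ := 0) (summable_g1_zero n μ ν w) t

/-- the open zone is open. [folklore] -/
private theorem isOpen_zone' : IsOpen (zone (d + 1)) := by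
  have : zone (d + 1) = ⋂ κ, {s : Fin (d + 1) → ℝ | |s κ| < Real.pi} := by
    ext s; simp [zone, Set.mem_iInter]
  rw [this]
  exact isOpen_iInter_of_finite fun κ =>
    isOpen_lt (continuous_abs.comp (continuous_apply κ)) continuous_const

/-- `0` is in the open zone. [folklore] -/
private theorem zero_mem_zone' : (0 : Fin (d + 1) → ℝ) ∈ zone (d + 1) := fun κ => by simp [Real.pi_pos]

/-- ray parameters near a zone parameter stay in the zone. [folklore] -/
private theorem ray_nhds_at (w : Fin (d + 1) → ℝ) {t₀ : ℝ} (h : t₀ • w ∈ zone (d + 1)) :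
    ∀ᶠ t in 𝓝 t₀, t • w ∈ zone (d + 1) :=
  (continuous_id.smul continuous_const).continuousAt.preimage_mem_nhds (isOpen_zone'.mem_nhds h)

/-- ray parameters near `0` stay in the zone. [folklore] -/
private theorem ray_nhds (w : Fin (d + 1) → ℝ) : ∀ᶠ t in 𝓝 (0 : ℝ), t • w ∈ zone (d + 1) :=
  ray_nhds_at w (by simpa using zero_mem_zone')

/-- on the zone the ray series IS `t ↦ Δ̃_{j,μν}(tw)` (§3). [folklore] -/
private theorem F0_eq (w : Fin (d + 1) → ℝ) {t : ℝ} (ht : t • w ∈ zone (d + 1)) :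
    ∑' x, g0 n μ ν w x t = symbDeltaJ n (t • w) μ ν := by
  rw [← (hasSum_kerDeltaJ_phase n μ ν (t • w) ht).tsum_eq]
  refine tsum_congr fun x => ?_
  simp only [g0, coef, phase_smul]
  congr 2
  ring

/-- on the zone, `t ↦ Δ̃_{j,μν}(tw)` has derivative `DΔ̃_{j,μν}(tw)w` (chain rule, file 1's `hasFDerivAt_symbDeltaJ`).
[folklore] -/
private theorem hasDerivAt_ray (w : Fin (d + 1) → ℝ) {t : ℝ} (ht : t • w ∈ zone (d + 1)) :
    HasDerivAt (fun t : ℝ => symbDeltaJ n (t • w) μ ν)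
      (fderiv ℝ (fun s : Fin (d + 1) → ℝ => symbDeltaJ n s μ ν) (t • w) w) t := by
  have hL : HasDerivAt (fun t : ℝ => t • w) w t := by simpa using (hasDerivAt_id t).smul_const w
  exact (hasFDerivAt_symbDeltaJ n μ ν (t • w) ht).comp_hasDerivAt t hL

/-- on the zone the termwise derivative IS the directional derivative: `Σ_x g1(t) = DΔ̃_{j,μν}(tw)w` (uniqueness
of derivatives). [folklore] -/
private theorem F1_eq (w : Fin (d + 1) → ℝ) {t : ℝ} (ht : t • w ∈ zone (d + 1)) :
    ∑' x, g1 n μ ν w x t = fderiv ℝ (fun s : Fin (d + 1) → ℝ => symbDeltaJ n s μ ν) (t • w) w := by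
  have h1 : HasDerivAt (fun t : ℝ => symbDeltaJ n (t • w) μ ν) (∑' x, g1 n μ ν w x t) t :=
    (hasDerivAt_F0 n μ ν w t).congr_of_eventuallyEq
      ((ray_nhds_at w ht).mono fun t' ht' => (F0_eq n μ ν w ht').symm)
  exact h1.unique (hasDerivAt_ray n μ ν w ht)

/-- first moments against the exponent = the first derivative at `0`: `Σ_x Δ_{j,μν}(x)(−i(w·x)) = DΔ̃_{j,μν}(0)w`.
[folklore] -/
private theorem hasSum_g1_zero (w : Fin (d + 1) → ℝ) :
    HasSum (fun x => kerDeltaJ n μ ν x * coef w x)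
      (fderiv ℝ (fun s : Fin (d + 1) → ℝ => symbDeltaJ n s μ ν) 0 w) := by
  have h := F1_eq n μ ν w (t := 0) (by simpa using zero_mem_zone')
  rw [zero_smul] at h
  have e : (fun x => kerDeltaJ n μ ν x * coef w x) = fun x => g1 n μ ν w x 0 := by
    funext x; simp [g1]
  rw [e, ← h]
  exact (summable_g1_zero n μ ν w).hasSum

/-- `t ↦ DΔ̃_{j,μν}(tw)w` has derivative `D²Δ̃_{j,μν}(0)(w,w)` at `t = 0` (file 1: `C²` at `0`, `hess`). [folklore] -/
private theorem hasDerivAt_fderiv_ray_zero (w : Fin (d + 1) → ℝ) :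
    HasDerivAt (fun t : ℝ => fderiv ℝ (fun s : Fin (d + 1) → ℝ => symbDeltaJ n s μ ν) (t • w) w)
      (hess n μ ν w w) 0 := by
  have hL : HasDerivAt (fun t : ℝ => t • w) w 0 := by simpa using (hasDerivAt_id (0 : ℝ)).smul_const w
  have h2 : ContDiffAt ℝ 2 (entry n μ ν) 0 := contDiffAt_symbDeltaJ n μ ν 0 zero_mem_zone'
  have h1 : ContDiffAt ℝ 1 (fderiv ℝ (entry n μ ν)) 0 := h2.fderiv_right (m := 1) le_rfl
  have hF0 : HasFDerivAt (fderiv ℝ (entry n μ ν)) (hess n μ ν) 0 :=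
    (h1.differentiableAt (by norm_num)).hasFDerivAt
  have hF : HasFDerivAt (fderiv ℝ (entry n μ ν)) (hess n μ ν) ((fun t : ℝ => t • w) 0) := by
    simpa using hF0
  have hc : HasDerivAt (fun t : ℝ => fderiv ℝ (entry n μ ν) (t • w)) (hess n μ ν w) 0 :=
    hF.comp_hasDerivAt (0 : ℝ) hL
  have hev := hc.clm_apply (hasDerivAt_const (0 : ℝ) w)
  simp only [zero_smul, map_zero, add_zero] at hev
  exact hev

/-- second moments against the exponent = the Hessian on the diagonal:
`Σ_x Δ_{j,μν}(x)(−i(w·x))² = D²Δ̃_{j,μν}(0)(w,w)`. [folklore] -/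
private theorem hasSum_g2_zero (w : Fin (d + 1) → ℝ) :
    HasSum (fun x => kerDeltaJ n μ ν x * (coef w x * coef w x)) (hess n μ ν w w) := by
  have hev : (fun t : ℝ => ∑' x, g1 n μ ν w x t) =ᶠ[𝓝 0]
      (fun t : ℝ => fderiv ℝ (fun s : Fin (d + 1) → ℝ => symbDeltaJ n s μ ν) (t • w) w) :=
    (ray_nhds w).mono fun t ht => F1_eq n μ ν w ht
  have hA : HasDerivAt (fun t : ℝ => ∑' x, g1 n μ ν w x t) (hess n μ ν w w) 0 :=
    (hasDerivAt_fderiv_ray_zero n μ ν w).congr_of_eventuallyEq hev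
  have e : ∑' x, g2 n μ ν w x 0 = hess n μ ν w w := (hasDerivAt_F1 n μ ν w 0).unique hA
  have e2 : (fun x => kerDeltaJ n μ ν x * (coef w x * coef w x)) = fun x => g2 n μ ν w x 0 := by
    funext x; simp [g2]
  rw [e2, ← e]
  exact (summable_g2_zero n μ ν w).hasSum

/-- **first lattice moments are first derivatives of the symbol at `0`**: `Σ_{x ∈ ℤ^{d+1}} Δ_{j,μν}(x)(w·x) =
i·DΔ̃_{j,μν}(0)w` (absolutely convergent), every direction `w`, every `n = L^j ≥ 1`; with `w = e_κ` this is
`−Σ_x x_κΔ_{j,μν}(x) = ((1/i)∂_κΔ̃_{j,μν})(0)`, the first «=» of (4.45). [cite: Balaban1987RG1, (4.45) p.292] -/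
theorem hasSum_kerDeltaJ_mul_phase (w : Fin (d + 1) → ℝ) :
    HasSum (fun x => kerDeltaJ n μ ν x * phase w x)
      (I * fderiv ℝ (fun s : Fin (d + 1) → ℝ => symbDeltaJ n s μ ν) 0 w) := by
  have h := (hasSum_g1_zero n μ ν w).mul_left I
  have e : (fun x => kerDeltaJ n μ ν x * phase w x) = fun x => I * (kerDeltaJ n μ ν x * coef w x) := by
    funext x
    simp only [coef]
    linear_combination (kerDeltaJ n μ ν x * phase w x) * Complex.I_sq
  rw [e]
  exact h

/-- **second lattice moments are minus the Hessian of the symbol at `0`, diagonal**: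
`Σ_{x ∈ ℤ^{d+1}} Δ_{j,μν}(x)(w·x)² = −D²Δ̃_{j,μν}(0)(w,w)`. [cite: Balaban1987RG1, (4.43) p.291] -/
theorem hasSum_kerDeltaJ_mul_phase_sq (w : Fin (d + 1) → ℝ) :
    HasSum (fun x => kerDeltaJ n μ ν x * phase w x ^ 2) (-(hess n μ ν w w)) := by
  have h := (hasSum_g2_zero n μ ν w).neg
  have e : (fun x => kerDeltaJ n μ ν x * phase w x ^ 2)
      = fun x => -(kerDeltaJ n μ ν x * (coef w x * coef w x)) := by
    funext x
    simp only [coef]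
    linear_combination (kerDeltaJ n μ ν x * phase w x ^ 2) * Complex.I_sq
  rw [e]
  exact h

/-- **… and polarized**: `Σ_{x ∈ ℤ^{d+1}} Δ_{j,μν}(x)(v·x)(w·x) = −D²Δ̃_{j,μν}(0)(v,w)` for all directions `v, w`
(`hess_symm`). [cite: Balaban1987RG1, (4.43) p.291] -/
theorem hasSum_kerDeltaJ_mul_phase_mul_phase (v w : Fin (d + 1) → ℝ) :
    HasSum (fun x => kerDeltaJ n μ ν x * (phase v x * phase w x)) (-(hess n μ ν v w)) := by
  have h1 := hasSum_kerDeltaJ_mul_phase_sq n μ ν (v + w)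
  have h2 := hasSum_kerDeltaJ_mul_phase_sq n μ ν v
  have h3 := hasSum_kerDeltaJ_mul_phase_sq n μ ν w
  have h := ((h1.sub h2).sub h3).mul_left (1 / 2 : ℂ)
  have hsym := hess_symm n μ ν v w
  have e : (fun x => kerDeltaJ n μ ν x * (phase v x * phase w x)) = fun x => (1 / 2 : ℂ) *
      (kerDeltaJ n μ ν x * phase (v + w) x ^ 2 - kerDeltaJ n μ ν x * phase v x ^ 2
        - kerDeltaJ n μ ν x * phase w x ^ 2) := by
    funext x
    simp only [phase_add]
    ring
  have ev : (1 / 2 : ℂ) * (-(hess n μ ν (v + w) (v + w)) - -(hess n μ ν v v) - -(hess n μ ν w w))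
      = -(hess n μ ν v w) := by
    simp only [map_add, add_apply]
    linear_combination (1 / 2 : ℂ) * hsym
  rw [e, ← ev]
  exact h

/-- `Σ_x x_κ Δ_{j,μν}(x) = 0` (the first coordinate moments vanish: `= i∂_κΔ̃_{j,μν}(0)` and file 1's
`fderiv_symbDeltaJ_zero`). [cite: Balaban1987RG1, (4.45) p.292] -/
theorem tsum_coord_mul_kerDeltaJ (κ : Fin (d + 1)) :
    ∑' x : Fin (d + 1) → ℤ, ((x κ : ℤ) : ℂ) * kerDeltaJ n μ ν x = 0 := by
  have h := (hasSum_kerDeltaJ_mul_phase n μ ν (eDir κ)).tsum_eq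
  rw [fderiv_symbDeltaJ_zero] at h
  simp only [phase_eDir] at h
  rw [← tsum_congr fun x => mul_comm (kerDeltaJ n μ ν x) ((x κ : ℤ) : ℂ), h]
  simp

/-- **the second coordinate moments are minus the Hessian entries**:
`Σ_x x_κ x_λ Δ_{j,μν}(x) = −D²Δ̃_{j,μν}(0)(e_κ, e_λ) = −(∂²/∂p′_κ∂p′_λ)Δ̃_{j,μν}(0)`. [cite: Balaban1987RG1, (4.43) p.291] -/
theorem tsum_coord_mul_coord_mul_kerDeltaJ (κ l : Fin (d + 1)) :
    ∑' x : Fin (d + 1) → ℤ, ((x κ : ℤ) : ℂ) * ((x l : ℤ) : ℂ) * kerDeltaJ n μ ν x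
      = -(hess n μ ν (eDir κ) (eDir l)) := by
  rw [← (hasSum_kerDeltaJ_mul_phase_mul_phase n μ ν (eDir κ) (eDir l)).tsum_eq]
  exact tsum_congr fun x => by rw [phase_eDir, phase_eDir]; ring

/-! ## §5. The printed displays (4.45) and (4.43), literally -/

/-- **(4.45), FIRST «=»**: `Σ_y Δ_{j,μν}(x − y)(y_κ − x_κ) = ((1/i)(∂/∂p′_κ)Δ̃_{j,μν})(0)` — for every base point
`x ∈ ℤ^{d+1}` (translation invariance), every `n = L^j ≥ 1`, all `μ ν κ`; the sum over the infinite unit lattice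
converges absolutely. [cite: Balaban1987RG1, (4.45) p.292] -/
theorem eq445_first (x₀ : Fin (d + 1) → ℤ) (κ : Fin (d + 1)) :
    ∑' y : Fin (d + 1) → ℤ, kerDeltaJ n μ ν (x₀ - y) * ((y κ - x₀ κ : ℤ) : ℂ)
      = 1 / I * fderiv ℝ (fun s : Fin (d + 1) → ℝ => symbDeltaJ n s μ ν) 0 (eDir κ) := by
  have h := (hasSum_kerDeltaJ_mul_phase n μ ν (eDir κ)).tsum_eq
  simp only [phase_eDir] at h
  rw [← Equiv.tsum_eq (Equiv.subLeft x₀)]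
  have e : ∀ z : Fin (d + 1) → ℤ,
      kerDeltaJ n μ ν (x₀ - (Equiv.subLeft x₀) z) * ((((Equiv.subLeft x₀) z) κ - x₀ κ : ℤ) : ℂ)
        = -(kerDeltaJ n μ ν z * ((z κ : ℤ) : ℂ)) := by
    intro z
    simp only [Equiv.subLeft_apply, sub_sub_cancel, Pi.sub_apply]
    push_cast
    ring
  rw [tsum_congr e, tsum_neg, h, one_div, Complex.inv_I]
  ring

/-- **(4.45)**, the whole display: `Σ_y Δ_{j,μν}(x − y)(y_κ − x_κ) = ((1/i)(∂/∂p′_κ)Δ̃_{j,μν})(0) = 0` («hence this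
term vanishes»), every `x`, every `n = L^j ≥ 1`. [cite: Balaban1987RG1, (4.45) p.292] -/
theorem eq445 (x₀ : Fin (d + 1) → ℤ) (κ : Fin (d + 1)) :
    ∑' y : Fin (d + 1) → ℤ, kerDeltaJ n μ ν (x₀ - y) * ((y κ - x₀ κ : ℤ) : ℂ) = 0 := by
  rw [eq445_first, fderiv_symbDeltaJ_zero]
  simp

/-- **(4.43), FIRST «=»**: `Σ_y Δ_{j,μν}(x − y)(y_κ − x_κ)(y_λ − x_λ) = −((∂²/∂p′_κ∂p′_λ)Δ̃_{j,μν})(0)`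
(`= −D²Δ̃_{j,μν}(0)(e_κ,e_λ) = −hess n μ ν e_κ e_λ`), every base point `x`, every `n = L^j ≥ 1`, all `μ ν κ λ`;
absolutely convergent over `ℤ^{d+1}`. [cite: Balaban1987RG1, (4.43) p.291] -/
theorem eq443_first (x₀ : Fin (d + 1) → ℤ) (κ l : Fin (d + 1)) :
    ∑' y : Fin (d + 1) → ℤ, kerDeltaJ n μ ν (x₀ - y) * (((y κ - x₀ κ : ℤ) : ℂ) * ((y l - x₀ l : ℤ) : ℂ))
      = -(hess n μ ν (eDir κ) (eDir l)) := by
  rw [← tsum_coord_mul_coord_mul_kerDeltaJ n μ ν κ l, ← Equiv.tsum_eq (Equiv.subLeft x₀)]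
  refine tsum_congr fun z => ?_
  simp only [Equiv.subLeft_apply, sub_sub_cancel, Pi.sub_apply]
  push_cast
  ring

/-- **(4.43)**, the whole display: `Σ_y Δ_{j,μν}(x − y)(y_κ − x_κ)(y_λ − x_λ) = −((∂²/∂p′_κ∂p′_λ)Δ̃_{j,μν})(0) =
δ_{μκ}δ_{νλ} + δ_{μλ}δ_{νκ} − 2δ_{μν}δ_{κλ}` (second «=»: file 1's `hess_eDir`), every `x`, every `n = L^j ≥ 1`.
[cite: Balaban1987RG1, (4.43) p.291] -/
theorem eq443 (x₀ : Fin (d + 1) → ℤ) (κ l : Fin (d + 1)) :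
    ∑' y : Fin (d + 1) → ℤ, kerDeltaJ n μ ν (x₀ - y) * (((y κ - x₀ κ : ℤ) : ℂ) * ((y l - x₀ l : ℤ) : ℂ))
      = ((kdR μ κ * kdR ν l + kdR μ l * kdR ν κ - 2 * (kdR μ ν * kdR κ l) : ℝ) : ℂ) := by
  rw [eq443_first, hess_eDir, neg_neg]

/-- (4.43) in the shape of the hypothesis `hM2` of the tree's (4.43) ⇒ (4.44) algebra
(`B12Marginal444.block2_of_moments443`, Kronecker symbol `B12Marginal444.kdA`, coefficient `β = 1`), for the
`ℤ^{d+1}` kernel. [cite: Balaban1987RG1, (4.43)–(4.44) p.291] -/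
theorem eq443_kdA (x₀ : Fin (d + 1) → ℤ) (κ l : Fin (d + 1)) :
    ∑' y : Fin (d + 1) → ℤ, kerDeltaJ n μ ν (x₀ - y) * (((y κ - x₀ κ : ℤ) : ℂ) * ((y l - x₀ l : ℤ) : ℂ))
      = B12Marginal444.kdA (A := ℂ) μ κ * B12Marginal444.kdA ν l
        + B12Marginal444.kdA μ l * B12Marginal444.kdA ν κ
        - 2 * B12Marginal444.kdA μ ν * B12Marginal444.kdA κ l := by
  have hk : ∀ a b : Fin (d + 1), ((kdR a b : ℝ) : ℂ) = B12Marginal444.kdA (A := ℂ) a b := fun a b => by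
    unfold kdR B12Marginal444.kdA; split_ifs <;> simp
  rw [eq443]
  push_cast
  simp only [hk]
  ring

end Kernel

end Literature.MathematicalPhysics.QuantumFieldTheory.Balaban1983to89.B12Eq443LatticeMoments
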